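import Summits.NavierStokesRegularity.NavierStokesRegularity.Theses.QuarterLogPincer
import Summits.NavierStokesRegularity.NavierStokesRegularity.Theses.SubcubicESS
import HarnessLib

/-!
# Route `QuarterLogPincer` (cell ns-idea-3, line A/B): the SHELF LINK
# `SubcubicESS.SubcubicBound` (stmt-10671) ⟹ `QuarterLogPincer.SubexpQuantESS` (stmt-23631)

Theorems file (seat ns-lqd-p1 g2 of cell ns-idea-3; `--supports` stmt-NavierStokesRegularity-23631).
Navier–Stokes regularity is NOT proved by anything here; no summit is.

Critic idea-crit-3 (re-verdict 2026-08-27T23:38Z, price P2) asked that the two quantitative-ESS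
cruxes be booked on ONE shelf with the order 10671 ⇒ 23631, and that the comparison be landed "if
the frames match verbatim". They do: both decls are `∃ F, (growth clause) ∧ (Tao-class frame)` with
the SAME frame (classical on `Icc 0 T` at `ν = 1`, all `Hⁿ` slice norms bounded, `L³` history
`≤ ofReal A`, `2 ≤ A`, conclusion `‖u t x‖ ≤ F A · t^{-1/2}` on `Ioc 0 T`), and the growth clauses are
`∀ ε > 0, F A ≤ ε A³ eventually` (subcubic) versus `∀ ε > 0, F A ≤ exp(ε A) eventually`
(subexponential). Since `A³ ≤ (εA)⁴/4! ≤ exp(εA)` for `A ≥ 24/ε⁴`, subcubic ⇒ subexponential: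

* `subexp_of_subcubic` — the growth comparison;
* `subexpQuantESS_of_subcubicBound` — the shelf link (DAG edge stmt-10671 ⇒ stmt-23631).
-/

noncomputable section

-- the summit and its single sub-problem share the name (CONVENTIONS §1), as in every Theorems file
set_option linter.dupNamespace false

namespace Summit.NavierStokesRegularity.NavierStokesRegularity.Theorems.QuarterLogPincer.Shelf

/-- **Subcubic growth is subexponential growth**: if for every `ε > 0`, `F A ≤ ε A³` for all large
`A`, then for every `ε > 0`, `F A ≤ exp(ε A)` for all large `A` (`A³ ≤ (εA)⁴/4! ≤ exp(εA)` once
`A ≥ 24/ε⁴`; only the case `ε = 1` of the hypothesis is used). -/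
theorem subexp_of_subcubic {F : ℝ → ℝ}
    (hF : ∀ ε : ℝ, 0 < ε → ∃ A₀ : ℝ, ∀ A : ℝ, A₀ ≤ A → F A ≤ ε * A ^ 3) :
    ∀ ε : ℝ, 0 < ε → ∃ A₀ : ℝ, ∀ A : ℝ, A₀ ≤ A → F A ≤ Real.exp (ε * A) := by
  intro ε hε
  obtain ⟨A₀, hA₀⟩ := hF 1 one_pos
  refine ⟨max A₀ (24 / ε ^ 4), fun A hA => ?_⟩
  have hA1 : A₀ ≤ A := le_trans (le_max_left _ _) hA
  have hA2 : 24 / ε ^ 4 ≤ A := le_trans (le_max_right _ _) hA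
  have hε4 : 0 < ε ^ 4 := by positivity
  have hApos : 0 < A := lt_of_lt_of_le (div_pos (by norm_num) hε4) hA2
  have h1 : F A ≤ 1 * A ^ 3 := hA₀ A hA1
  have h2 : (ε * A) ^ 4 / (Nat.factorial 4 : ℝ) ≤ Real.exp (ε * A) :=
    Real.pow_div_factorial_le_exp (ε * A) (by positivity) 4
  have h24 : ((Nat.factorial 4 : ℕ) : ℝ) = 24 := by norm_num [Nat.factorial]
  have h3 : A ^ 3 ≤ (ε * A) ^ 4 / (Nat.factorial 4 : ℝ) := by
    rw [h24, le_div_iff₀ (by norm_num : (0 : ℝ) < 24)]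
    have h5 : 24 ≤ ε ^ 4 * A := by
      have := hA2
      rwa [div_le_iff₀ hε4, mul_comm] at this
    calc A ^ 3 * 24 ≤ A ^ 3 * (ε ^ 4 * A) :=
          mul_le_mul_of_nonneg_left h5 (pow_pos hApos 3).le
      _ = (ε * A) ^ 4 := by ring
  linarith

/-- **Shelf link (DAG edge stmt-10671 ⇒ stmt-23631)**: `SubcubicESS.SubcubicBound` implies
`QuarterLogPincer.SubexpQuantESS` — same witness `F`, same Tao-class frame verbatim, growth clause
weakened by `subexp_of_subcubic`. -/
theorem subexpQuantESS_of_subcubicBound :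
    Theses.SubcubicESS.SubcubicBound → Theses.QuarterLogPincer.SubexpQuantESS := by
  rintro ⟨F, hF, hmain⟩
  exact ⟨F, subexp_of_subcubic hF, hmain⟩

end Summit.NavierStokesRegularity.NavierStokesRegularity.Theorems.QuarterLogPincer.Shelf

end
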